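import Summits.ABC.ABC.Theses.BelyiSqueeze
import Literature.NumberTheory.DiophantineGeometry.BelyiPolynomialWitness

/-!
# `BelyiSqueeze.DegBelyiRadical` in the tree's Belyi-degree vocabulary

Proof-only file over the CLOSED route ABC/BelyiSqueeze (`Summits/ABC/ABC/Theses/BelyiSqueeze.lean`,
closed·refuted 2026-08-15 through its crux `DegBelyiLower`). Its other crux, item stmt-ABC-1206
`DegBelyiRadical` ("conductor-effective Belyi"), inlines "the four-pointed line `(ℙ¹; 0, 1, ∞, a/c)`
carries a Belyi map of degree `n`" as a cross-ratio normal form (`∞` not special, four marked special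
points of cross-ratio `a/c`). The Literature side has since acquired the vocabulary
`Literature.NumberTheory.DiophantineGeometry.HasBelyiWitness` / `belyiDegree` (`BelyiDegree.lean`) and the
equivalence of the two normal forms `hasBelyiWitness_iff_exists_crossRatio` (`BelyiPolynomialWitness.lean`).

* `degBelyiRadical_iff_belyiDegree_le` — **`DegBelyiRadical ↔ ∀ ε > 0 ∃ C > 0 ∀ abc triples,
  deg_B(ℙ¹; 0,1,∞,a/c) ≤ C · rad(abc)^{1+ε}`**, i.e. the crux is *literally* the sentence "the Belyi degree
  of the pointed line through `a/c` is `≪_ε rad(abc)^{1+ε}`" with `deg_B = belyiDegree`.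
* `belyiDegree_le_radical_of_abc` — the right-hand side follows from abc (Belyĭ's bound
  `deg_B(a/c) ≤ c`, `IsABCTriple.belyiDegree_le`); composed with the iff this is the landed
  `degBelyiRadical_of_abc` (`BelyiSqueezeDegBelyiRadicalOfABC.lean`, not restated here).

Reading (cell abc-iut, FACT-LIST row F-2686; seat abc-iut-f-160 gen 3): the decl is an abc-implied,
unproved statement about Belyi degrees — not a published theorem (the list's tag «[GenEll] Thm 3.2» matches
no item of Mochizuki's *Arithmetic Elliptic Curves in General Position*, whose §3 runs Lemma 3.1 – Theorem 3.8;
the "Thm 3.2" in the route docstring is Goldring 2011 Thm 3.2, the Riemann–Hurwitz/Mason–Stothers equality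
case justifying the inlined normal form). Nothing here asserts abc proved or refuted.
-/

set_option linter.dupNamespace false

namespace Summit.ABC.ABC.Theorems

open Literature.NumberTheory.DiophantineGeometry
open Summit.ABC.ABC.Theses.BelyiSqueeze

/-- For an abc triple `a + b = c` the fourth point `a/c ∈ ℂ` is neither `0` nor `1`. [folklore] -/
private theorem ratio_ne_zero_one {a b c : ℕ} (h : IsABCTriple a b c) :
    (a : ℂ) / (c : ℂ) ≠ 0 ∧ (a : ℂ) / (c : ℂ) ≠ 1 := by
  have ha : 0 < a := h.1
  have hb : 0 < b := h.2.1
  have hc : a + b = c := h.2.2.1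
  have hc0 : (c : ℂ) ≠ 0 := by exact_mod_cast (show c ≠ 0 by omega)
  refine ⟨div_ne_zero (by exact_mod_cast ha.ne') hc0, ?_⟩
  rw [Ne, div_eq_one_iff_eq hc0]
  exact_mod_cast (show a ≠ c by omega)

/-- **`DegBelyiRadical` is the sentence `deg_B(ℙ¹; 0, 1, ∞, a/c) ≪_ε rad(abc)^{1+ε}`**: the route's crux
(inlined cross-ratio normal form, witness in degree exactly `n ≤ C·rad^{1+ε}`) holds iff for every `ε > 0`
there is `C > 0` with `belyiDegree (a/c) ≤ C · rad(abc)^{1+ε}` for every abc triple. (`→`: a cross-ratio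
witness of degree `n` is a `HasBelyiWitness n (a/c)` by `hasBelyiWitness_iff_exists_crossRatio`, so
`belyiDegree ≤ n`; `←`: the Belyi degree is attained, `hasBelyiWitness_belyiDegree`, a witness existing by
Belyĭ's polynomial `IsABCTriple.exists_hasBelyiWitness`, and is converted back to the cross-ratio form.)
[cite: Zapponi2009BelyiDegree, §1.1] [cite: Goldring2011, Thm 3.2] -/
theorem degBelyiRadical_iff_belyiDegree_le :
    Summit.ABC.ABC.Theses.BelyiSqueeze.DegBelyiRadical ↔
      ∀ ε : ℝ, 0 < ε → ∃ C : ℝ, 0 < C ∧ ∀ a b c : ℕ, IsABCTriple a b c →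
        (belyiDegree ((a : ℂ) / (c : ℂ)) : ℝ) ≤ C * ((rad a b c : ℕ) : ℝ) ^ (1 + ε) := by
  constructor
  · intro h ε hε
    obtain ⟨C, hC, hall⟩ := h ε hε
    refine ⟨C, hC, fun a b c ht => ?_⟩
    obtain ⟨n, hn, P, Q, x, y, z, w, hw⟩ := hall a b c ht
    obtain ⟨h0, h1⟩ := ratio_ne_zero_one ht
    have hW : HasBelyiWitness n ((a : ℂ) / (c : ℂ)) :=
      (hasBelyiWitness_iff_exists_crossRatio h0 h1).mpr ⟨P, Q, x, y, z, w, hw⟩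
    have hle : belyiDegree ((a : ℂ) / (c : ℂ)) ≤ n :=
      Literature.NumberTheory.DiophantineGeometry.belyiDegree_le hW
    calc (belyiDegree ((a : ℂ) / (c : ℂ)) : ℝ) ≤ (n : ℝ) := by exact_mod_cast hle
      _ ≤ C * ((rad a b c : ℕ) : ℝ) ^ (1 + ε) := hn
  · intro h ε hε
    obtain ⟨C, hC, hall⟩ := h ε hε
    refine ⟨C, hC, fun a b c ht => ⟨belyiDegree ((a : ℂ) / (c : ℂ)), hall a b c ht, ?_⟩⟩
    obtain ⟨h0, h1⟩ := ratio_ne_zero_one ht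
    exact (hasBelyiWitness_iff_exists_crossRatio h0 h1).mp
      (hasBelyiWitness_belyiDegree ht.exists_hasBelyiWitness)

/-- **abc ⟹ `deg_B(a/c) ≪_ε rad(abc)^{1+ε}`** (Belyi-degree form of `degBelyiRadical_of_abc`): with the abc
constant `C_ε`, Belyĭ's bound `belyiDegree (a/c) ≤ c` (`IsABCTriple.belyiDegree_le`) gives
`belyiDegree (a/c) ≤ c < C_ε · rad^{1+ε}`. [cite: Belyi1980, §3] -/
theorem belyiDegree_le_radical_of_abc (hABC : _root_.ABC) :
    ∀ ε : ℝ, 0 < ε → ∃ C : ℝ, 0 < C ∧ ∀ a b c : ℕ, IsABCTriple a b c →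
      (belyiDegree ((a : ℂ) / (c : ℂ)) : ℝ) ≤ C * ((rad a b c : ℕ) : ℝ) ^ (1 + ε) := by
  intro ε hε
  obtain ⟨C, hC, hbound⟩ := hABC ε hε
  refine ⟨C, hC, fun a b c ht => ?_⟩
  have hle : belyiDegree ((a : ℂ) / (c : ℂ)) ≤ c := ht.belyiDegree_le
  calc (belyiDegree ((a : ℂ) / (c : ℂ)) : ℝ) ≤ (c : ℝ) := by exact_mod_cast hle
    _ ≤ C * ((rad a b c : ℕ) : ℝ) ^ (1 + ε) := (hbound a b c ht).le

end Summit.ABC.ABC.Theorems
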